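import Summits.MatrixMultiplication.MatrixMultiplication.Theses.ThinBlockAlpha

/-!
# Rigid tiling charts WITH a B-fat symbol exist (refuter drefute, line `tame-charts`)

The line card (`Lines/tame-charts.md`, F5), triage r1-3 ("first NEGATIVE stub") and the lead's parallel
track (3) propose to retire the line by the structural Negative lemma

  `(∀ x, SymbolTPP (SA x) (SB x) (SC x)) → PiecesTile SA SC → IsRigid SA SB SC → ∀ x, (SB x).card ≤ 1`

("tiling + rigidity ⇒ all `b_x = 1`").  It is FALSE: the two-symbol chart over `ZMod 7`
`π = ({0,6,5}, {0}, {0,3})`, `x = ({0}, {4,5}, {6})` has TPP symbols, pieces `D_π = {0,…,5}`, `D_x = {6}`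
tiling `ZMod 7`, off-diagonal bad patterns exactly `(π,x,π), (x,π,π), (x,x,π)`, and the Gordan certificate
`φ(π) = (0,0,0)`, `φ(x) = (1,1,−2)`; and `|SB x| = 2`.  (A second witness with a non-point fat piece,
`q_x = 2`: `ZMod 11`, `π = ({0,10,9},{0},{0,3,6})`, `x = ({0},{5,8},{9,10})`.)  General family: a
near-factorisation `U + V = ZMod n ∖ J` plus a fat symbol `({0}, B, J)` with `B` avoiding `U`, `U ± δ`, `J − V`.
None of these is `ThinEnough` (θ = 6Σq log b/Σ q log q ≈ 0.39 < 1), so `stub_existsTameThinChart` is untouched;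
the point is that any kill of stub 5 must use `ThinEnough` quantitatively — the hashing-free structural
squeeze alone does not close.

Definitions below are VERBATIM copies of `Cruxes/BoundedExponentThird/Lines/tame-charts.lean`
(that file is a workfile, not an importable module).
-/

set_option linter.dupNamespace false

namespace Summit.MatrixMultiplication.MatrixMultiplication.Cruxes.BoundedExponentThird.TameChartsNegative

open Finset

/-- verbatim copy of `TameCharts.SymbolTPP`. -/
def SymbolTPP {Z : Type} [AddCommGroup Z] (A B C : Finset Z) : Prop :=
  ∀ a ∈ A, ∀ a' ∈ A, ∀ b ∈ B, ∀ b' ∈ B, ∀ c ∈ C, ∀ c' ∈ C,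
    (a' - a) + (b' - b) + (c' - c) = 0 → a = a' ∧ b = b' ∧ c = c'

/-- verbatim copy of `TameCharts.Bad`. -/
def Bad {Z : Type} [AddCommGroup Z] {k : ℕ} (SA SB SC : Fin k → Finset Z) (x y z : Fin k) : Prop :=
  ∃ s' ∈ SA x, ∃ s ∈ SA z, ∃ t' ∈ SB y, ∃ t ∈ SB x, ∃ u' ∈ SC z, ∃ u ∈ SC y,
    (s' - s) + (t' - t) + (u' - u) = 0

/-- verbatim copy of `TameCharts.IsRigid`. -/
def IsRigid {Z : Type} [AddCommGroup Z] {k : ℕ} (SA SB SC : Fin k → Finset Z) : Prop :=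
  ∃ φ₁ φ₂ φ₃ : Fin k → ℤ, (∀ x, φ₁ x + φ₂ x + φ₃ x = 0) ∧
    ∀ x y z : Fin k, Bad SA SB SC x y z → ¬ (x = y ∧ y = z) → 0 < φ₁ x + φ₂ y + φ₃ z

/-- verbatim copy of `TameCharts.PiecesTile`. -/
def PiecesTile {Z : Type} [AddCommGroup Z] {k : ℕ} (SA SC : Fin k → Finset Z) : Prop :=
  (∀ g : Z, ∃ x, ∃ a ∈ SA x, ∃ c ∈ SC x, c - a = g) ∧
  (∀ x y, ∀ a ∈ SA x, ∀ c ∈ SC x, ∀ a' ∈ SA y, ∀ c' ∈ SC y, c - a = c' - a' → x = y)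

/-- verbatim copy of `TameCharts.pieceSize`. -/
def pieceSize {Z : Type} {k : ℕ} (SA SC : Fin k → Finset Z) (x : Fin k) : ℕ := (SA x).card * (SC x).card

/-! ## Witness 1: `ZMod 7`, `π = ({0,6,5},{0},{0,3})`, `x = ({0},{4,5},{6})` -/

/-- first legs. -/
def z7A : Fin 2 → Finset (ZMod 7) := ![{0, 6, 5}, {0}]
/-- middle legs (`x` is B-fat). -/
def z7B : Fin 2 → Finset (ZMod 7) := ![{0}, {4, 5}]
/-- last legs. -/
def z7C : Fin 2 → Finset (ZMod 7) := ![{0, 3}, {6}]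

theorem z7_tpp : ∀ x, SymbolTPP (z7A x) (z7B x) (z7C x) := by
  unfold SymbolTPP z7A z7B z7C; decide

theorem z7_tile : PiecesTile z7A z7C := by
  unfold PiecesTile z7A z7C; decide

theorem z7_fat : 2 ≤ (z7B 1).card := by decide

theorem z7_rigid : IsRigid z7A z7B z7C := by
  refine ⟨![0, 1], ![0, 1], ![0, -2], by decide, ?_⟩
  unfold Bad z7A z7B z7C
  decide

/-! ## Witness 2: `ZMod 11`, `π = ({0,10,9},{0},{0,3,6})`, `x = ({0},{5,8},{9,10})` — fat AND `q_x = 2` -/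

/-- first legs (witness 2). -/
def z11A : Fin 2 → Finset (ZMod 11) := ![{0, 10, 9}, {0}]
/-- middle legs (witness 2, `x` B-fat). -/
def z11B : Fin 2 → Finset (ZMod 11) := ![{0}, {5, 8}]
/-- last legs (witness 2). -/
def z11C : Fin 2 → Finset (ZMod 11) := ![{0, 3, 6}, {9, 10}]

theorem z11_tpp : ∀ x, SymbolTPP (z11A x) (z11B x) (z11C x) := by
  unfold SymbolTPP z11A z11B z11C; decide

theorem z11_tile : PiecesTile z11A z11C := by
  unfold PiecesTile z11A z11C; decide

theorem z11_fat : 2 ≤ (z11B 1).card ∧ 2 ≤ pieceSize z11A z11C 1 := by decide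

theorem z11_rigid : IsRigid z11A z11B z11C := by
  refine ⟨![0, 1], ![0, 1], ![0, -2], by decide, ?_⟩
  unfold Bad z11A z11B z11C
  decide

/-- **The structural Negative lemma of the line card (F5 / triage r1-3) is false**: tiling + TPP + Gordan
rigidity do NOT force every middle set to be a point. -/
theorem not_rigid_tiling_forces_thin_middle :
    ¬ (∀ (Z : Type) [AddCommGroup Z] (k : ℕ) (SA SB SC : Fin k → Finset Z),
        (∀ x, SymbolTPP (SA x) (SB x) (SC x)) → PiecesTile SA SC → IsRigid SA SB SC →
        ∀ x, (SB x).card ≤ 1) := by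
  intro h
  have := h (ZMod 7) 2 z7A z7B z7C z7_tpp z7_tile z7_rigid 1
  have h2 := z7_fat
  omega

end Summit.MatrixMultiplication.MatrixMultiplication.Cruxes.BoundedExponentThird.TameChartsNegative
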